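/-
Copyright (c) 2026 the pub-hodgecm-mathlib formalisation cell (harness21).  Prover seat hodgecm-mathlib-K2E1-p08 (g3), Track B ∕ K2-LIT
(build stream 29), h413 = `stmt-HodgeConjecture-24833`, line `K2_E1_TraceFormulaBeta`, row 10 (DEAL F ∕ G1: the global twist `ε` of `G̃ = Res_{E∕F} GL_n`);
dealer K2E1-plan (g2) RULING «G1 GO» 2026-09-04T01:27:06Z.  2026-09-04.
-/
import Summits.HodgeConjecture.HodgeConjecture.Theorems.K2E1GlobalTestFunctionsTwistedDefs   -- ★ (K2E1-p05 g2): `twistAdelic`, `twistLocal`, `formAdelic`, `formLocal`, `locCompGt_twistAdelic` (brings ★ `Ch4Sec10.unitaryTwist`)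
import Literature.NumberTheory.Automorphic.Liu2021.LemD1DataOfPlace                     -- ★ `conjLocal_conjLocal_apply` (`(c ⊗ 1)² = 1` on `E_v`)
import Literature.NumberTheory.Automorphic.UnitaryGroupGlobalGenericity              -- ★ `conjAdele_conjAdele` (`(c ⊗ 1)² = 1` on `𝔸_E`)
import HarnessLib

/-!
# h413 ∕ Track B «K2-LIT», line `K2_E1_TraceFormulaBeta`, row 10 (G1) — `K2E1TwistEpsilonInvolution`: the twist `ε(g) = Φ⁻¹((σg)ᵀ)⁻¹Φ` of `G̃ = Res_{E∕F} GL_n`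
# is FUNCTORIAL in the coefficient ring and an INVOLUTION for `σ`-hermitian `Φ`; hence the adelic twist preserves the rational points `GL_n(E)` and `ε ∘ ε = id`
# on `GL_n(𝔸_E)`, `GL_n(E_v)`, `GL_n(E)`

Cell `pub/hodgecm-mathlib`, crux H413 = `stmt-HodgeConjecture-24833`, route of record `HCCMUnconditional`; chair K2-lead (g0), dealer K2E1-plan (g2) (DEAL F survey
`K2/K2E1-p08/g3/MEMO-DEALF-row10-survey.K2E1-p08-g3.md` 4760e99696e79e93 READ «=», RULING «G1 GO» 01:27:06Z: «global `ε` on `GL₃(𝔸_E)`: polynomial involution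
`unitaryTwist` adelised, preserves `GL₃(E)`, `K`-a.e., `ε∘ε = id`; theorems-only over ★ `Ch4Sec10.unitaryTwist` ∕ ★ TwistedDefs — cite, do not re-define»).  First rung: the
ALGEBRA of ★ `Literature.NumberTheory.Rogawski1990.Ch4Sec10.unitaryTwist σ Φ : GL n R →* GL n R` [Rogawski1990 §3.10 p. 33 «`ε` induces `σ` on `G(E)`»; §4.7 p. 47] for ANY
commutative ring: (i) FUNCTORIALITY along a ring homomorphism `f : R →+* S` intertwining `σ` and `τ` (`map f ∘ ε_{σ,Φ} = ε_{τ, fΦ} ∘ map f`) — read at `f = (E ↪ 𝔸_E)`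
(★ `algebraMap_conj`) it says the adelic twist ★ `twistAdelic` PRESERVES THE RATIONAL POINTS `GL_n(E) ⊂ GL_n(𝔸_E)` and restricts there to the rational twist
`unitaryTwist c Φ`; read at `f = (𝔸_E → E_v)` it is ★ `locCompGt_twistAdelic`; (ii) INVOLUTIVITY `ε (ε g) = g` when `σ ∘ σ = id` and `Φ` is `σ`-HERMITIAN (`((Φ)ᵀ).map σ = Φ`)
— read over `𝔸_E` (★ `conjAdele_conjAdele`), over `E_v` (★ `conjLocal_conjLocal_apply`) and over `E`.  THEOREMS ONLY (no `def`, no `instance`, no `notation`, no named-fact hypothesis,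
no `sorry`); lane `--kind proof --supports stmt-HodgeConjecture-24833 --as helper`.  Next rungs of G1 (levels `ε_v(GL_n(Π𝒪_w)) = GL_n(Π𝒪_w)` a.e.; the archimedean component and
★ `IsArchSmooth`; the `twist` of ★ `GlobalTestFunctionGt`) follow in sibling files.

* §1 (any `R`) `coe_unitaryTwist` (matrix of `ε g`), `map_glTransposeInv` (entrywise ring maps commute with `g ↦ (gᵀ)⁻¹`), **`map_unitaryTwist`** (functoriality),
  `glTransposeInv_glTransposeInv'`, `glTransposeInv_map_of_hermitian` (`((σΦ)ᵀ)⁻¹ = Φ⁻¹`), **`unitaryTwist_unitaryTwist`** (involution).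
* §2 (`E ∕ F`, `c`) `map_formAdelic_conjAdele_transpose` (hermitian over `E` ⟹ hermitian over `𝔸_E`),
  **`twistAdelic_map_algebraMap_mem_range`** (`ε(γ ⊗ 1) = γ′ ⊗ 1`: rational points preserved), **`twistAdelic_twistAdelic`**, `map_formLocal_conjLocal_transpose`, `twistLocal_twistLocal`,
  `twistLocal_map_algebraMap_mem_range`.

HONEST LABEL.  Count-neutral helper; closes no socket by itself; HC_CM is proved only modulo the 7 printed citations (2 remaining named inputs: hLiu418 =
`stmt-HodgeConjecture-24832`, h413 = `stmt-HodgeConjecture-24833`) until rung 0 closes.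

## References
* [Rogawski1990] J. D. Rogawski, *Automorphic Representations of Unitary Groups in Three Variables* (1990), §3.10 p. 33, §3.11 p. 35, §4.7 p. 47, §4.10 p. 57.
* [CasselsFrohlichANT1967] J. W. S. Cassels, A. Fröhlich (eds.), *Algebraic Number Theory* (1967), Ch. VII §1.1 (the Galois action on adeles and completions).
-/

set_option autoImplicit false
-- the mandated namespace repeats `HodgeConjecture.HodgeConjecture`, as in every `Theorems/*.lean` of this sub-problem
set_option linter.dupNamespace false

noncomputable section

open NumberField IsDedekindDomain Set
open scoped MatrixGroups Matrix

namespace Summit.HodgeConjecture.HodgeConjecture.Cruxes.H413.K2E1TwistEpsilonInvolution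

open Literature.NumberTheory.Automorphic Literature.NumberTheory.Automorphic.UnitaryGroup
open Literature.NumberTheory.Rogawski1990.Ch4Sec10 (unitaryTwist)
open Literature.NumberTheory.GaloisRepresentations (glTransposeInv coe_glTransposeInv_apply)
open Summit.HodgeConjecture.HodgeConjecture.Cruxes.H413.K2E1GlobalTestFunctionsTwisted

/-! ## §1 The twist over any commutative ring: functoriality and involutivity -/

section Ring

variable {R S : Type*} [CommRing R] [CommRing S] [TopologicalSpace R] [TopologicalSpace S] {n : Type*} [Fintype n] [DecidableEq n]

/-- **Unfolding of the twist in the group**: `ε_{σ,Φ}(g) = Φ⁻¹ · ((σg)ᵀ)⁻¹ · (Φ⁻¹)⁻¹` (★ `unitaryTwist` = conjugation by `Φ⁻¹` after ★ `glTransposeInv` after entrywise `σ`).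
[cite: Rogawski1990, §3.10 p. 33] -/
theorem unitaryTwist_apply (σ : R →+* R) (Φ : GL n R) (g : GL n R) :
    unitaryTwist σ Φ g = Φ⁻¹ * glTransposeInv n R (Matrix.GeneralLinearGroup.map σ g) * Φ⁻¹⁻¹ :=
  rfl

/-- **Entrywise ring homomorphisms commute with `g ↦ (gᵀ)⁻¹`.** [folklore] -/
theorem map_glTransposeInv (f : R →+* S) (h : GL n R) :
    Matrix.GeneralLinearGroup.map f (glTransposeInv n R h) = glTransposeInv n S (Matrix.GeneralLinearGroup.map f h) :=
  Units.ext (by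
    change (((h⁻¹ : GL n R) : Matrix n n R)ᵀ).map f = (((Matrix.GeneralLinearGroup.map f h)⁻¹ : GL n S) : Matrix n n S)ᵀ
    rw [← map_inv, Matrix.transpose_map]
    rfl)

/-- **FUNCTORIALITY OF THE TWIST**: for a ring homomorphism `f : R →+* S` intertwining the involutions (`f ∘ σ = τ ∘ f`), `f(ε_{σ,Φ}(g)) = ε_{τ,f(Φ)}(f(g))` entrywise.  Instances: `f = (E ↪ 𝔸_E)`
(rational points, §2), `f = (𝔸_E → E_v)` (★ `locCompGt_twistAdelic`), `f = (E ↪ E_v)`. [cite: Rogawski1990, §3.10 p. 33; §4.7 p. 47] -/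
theorem map_unitaryTwist (σ : R →+* R) (τ : S →+* S) (f : R →+* S) (hf : ∀ x, f (σ x) = τ (f x)) (Φ g : GL n R) :
    Matrix.GeneralLinearGroup.map f (unitaryTwist σ Φ g) =
      unitaryTwist τ (Matrix.GeneralLinearGroup.map f Φ) (Matrix.GeneralLinearGroup.map f g) := by
  have hcomp : f.comp σ = τ.comp f := RingHom.ext hf
  have hfg : Matrix.GeneralLinearGroup.map f (Matrix.GeneralLinearGroup.map σ g) = Matrix.GeneralLinearGroup.map τ (Matrix.GeneralLinearGroup.map f g) := by
    change ((Matrix.GeneralLinearGroup.map f).comp (Matrix.GeneralLinearGroup.map σ)) g =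
      ((Matrix.GeneralLinearGroup.map τ).comp (Matrix.GeneralLinearGroup.map f)) g
    rw [← Matrix.GeneralLinearGroup.map_comp, ← Matrix.GeneralLinearGroup.map_comp, hcomp]
  rw [unitaryTwist_apply, unitaryTwist_apply, map_mul, map_mul, map_inv, map_inv, map_inv, map_glTransposeInv, hfg]

/-- `(gᵀ)⁻¹` twice is `g`. [folklore] -/
theorem glTransposeInv_glTransposeInv' (g : GL n R) : glTransposeInv n R (glTransposeInv n R g) = g :=
  Units.ext (by rw [coe_glTransposeInv_apply, ← map_inv, coe_glTransposeInv_apply, inv_inv, Matrix.transpose_transpose])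

/-- **For a `σ`-hermitian `Φ` (`((Φ)ᵀ).map σ = Φ`), `((σΦ)ᵀ)⁻¹ = Φ⁻¹`** in `GL n R`. [cite: Rogawski1990, §3.10 p. 33; §1.9 p. 8] -/
theorem glTransposeInv_map_of_hermitian (σ : R →+* R) {Φ : GL n R} (hΦ : ((Φ : GL n R) : Matrix n n R)ᵀ.map σ = (Φ : Matrix n n R)) :
    glTransposeInv n R (Matrix.GeneralLinearGroup.map σ Φ) = Φ⁻¹ := by
  -- both sides are inverses of `σΦᵀ = Φ` (`Matrix.transpose_map`)
  have hT : ((Matrix.GeneralLinearGroup.map σ Φ : GL n R) : Matrix n n R)ᵀ = (Φ : Matrix n n R) := by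
    change ((Φ : Matrix n n R).map σ)ᵀ = (Φ : Matrix n n R)
    rw [← Matrix.transpose_map, hΦ]
  refine Units.ext ?_
  rw [coe_glTransposeInv_apply, Matrix.coe_units_inv, Matrix.coe_units_inv, Matrix.transpose_nonsing_inv, hT]

/-- **THE TWIST IS AN INVOLUTION**: if `σ ∘ σ = id` and `Φ` is `σ`-hermitian (`((Φ)ᵀ).map σ = Φ`), then `ε_{σ,Φ}(ε_{σ,Φ}(g)) = g` — `ε = Φ⁻¹ · T(S g) · Φ` with `T = (·ᵀ)⁻¹`, `S = σ` entrywise commuting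
involutive homomorphisms and `T(S Φ) = Φ⁻¹` (★ `unitaryTwist` docstring: «For `σ` an involution and `Φ` σ-hermitian, `ε ∘ ε = id`»; print: `ε` has order 2 on `G̃`).
[cite: Rogawski1990, §3.10 p. 33; §4.7 p. 47] -/
theorem unitaryTwist_unitaryTwist (σ : R →+* R) (hσ : ∀ x, σ (σ x) = x) {Φ : GL n R} (hΦ : ((Φ : GL n R) : Matrix n n R)ᵀ.map σ = (Φ : Matrix n n R))
    (g : GL n R) : unitaryTwist σ Φ (unitaryTwist σ Φ g) = g := by
  have hσσ : σ.comp σ = RingHom.id R := RingHom.ext hσ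
  have hSS : ∀ h : GL n R, Matrix.GeneralLinearGroup.map σ (Matrix.GeneralLinearGroup.map σ h) = h := fun h => by
    rw [← Matrix.GeneralLinearGroup.map_comp_apply, ← Matrix.GeneralLinearGroup.map_comp, hσσ, Matrix.GeneralLinearGroup.map_id]
    rfl
  have hΦ' := glTransposeInv_map_of_hermitian σ hΦ
  rw [unitaryTwist_apply, unitaryTwist_apply]
  simp only [map_mul, map_inv, inv_inv, map_glTransposeInv, hSS, hΦ', glTransposeInv_glTransposeInv']
  group

end Ring

/-! ## §2 The adelic, local and rational twists of `G̃ = Res_{E∕F} GL_n` -/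

section Global

variable (F E : Type) [Field F] [NumberField F] [Field E] [NumberField E] [Algebra F E] (n : ℕ) (Φ : GL (Fin n) E) (c : E ≃ₐ[F] E)

omit [NumberField F] in
/-- **A `c`-hermitian `Φ ∈ GL_n(E)` stays hermitian over `𝔸_E`**: `((Φ ⊗ 1)ᵀ).map (c ⊗ 1) = Φ ⊗ 1` (★ `algebraMap_conj`). [cite: Rogawski1990, §1.9 p. 8] -/
theorem map_formAdelic_conjAdele_transpose (hΦ : ((Φ : GL (Fin n) E) : Matrix (Fin n) (Fin n) E)ᵀ.map c = (Φ : Matrix (Fin n) (Fin n) E)) :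
    ((formAdelic E n Φ : GL (Fin n) (AdeleRing (𝓞 E) E)) : Matrix (Fin n) (Fin n) (AdeleRing (𝓞 E) E))ᵀ.map (conjAdele F E c) =
      (formAdelic E n Φ : Matrix (Fin n) (Fin n) (AdeleRing (𝓞 E) E)) := by
  ext i j
  have hij : c ((Φ : Matrix (Fin n) (Fin n) E) j i) = (Φ : Matrix (Fin n) (Fin n) E) i j := by
    have h := congrFun (congrFun hΦ i) j
    rwa [Matrix.map_apply, Matrix.transpose_apply] at h
  change conjAdele F E c (algebraMap E (AdeleRing (𝓞 E) E) ((Φ : Matrix (Fin n) (Fin n) E) j i)) = algebraMap E (AdeleRing (𝓞 E) E) ((Φ : Matrix (Fin n) (Fin n) E) i j)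
  rw [← algebraMap_conj, RingHom.coe_coe, hij]

omit [NumberField F] in
/-- **THE ADELIC TWIST PRESERVES THE RATIONAL POINTS**: for `γ ∈ GL_n(E)`, `ε(γ ⊗ 1) = γ′ ⊗ 1` with `γ′ = Φ⁻¹((cγ)ᵀ)⁻¹Φ ∈ GL_n(E)` the rational twist (§1 functoriality at `E ↪ 𝔸_E`,
★ `algebraMap_conj`; the rational twist is ★ `unitaryTwist c Φ` for any topology on `E`, here the discrete one inside the proof) — print: «we identify `G̃` with `G(E)` … `ε`
induces `σ` on `G(E)`».  So `ε` maps `GL_n(E) · g` to `GL_n(E) · ε(g)` and descends to `[G̃] = GL_n(E)∖GL_n(𝔸_E)` (G2). [cite: Rogawski1990, §3.10 p. 33; §4.7 p. 47] -/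
theorem twistAdelic_map_algebraMap_mem_range (γ : GL (Fin n) E) :
    twistAdelic F E n Φ c (Matrix.GeneralLinearGroup.map (algebraMap E (AdeleRing (𝓞 E) E)) γ) ∈
      (Matrix.GeneralLinearGroup.map (n := Fin n) (algebraMap E (AdeleRing (𝓞 E) E))).range := by
  letI : TopologicalSpace E := ⊥
  refine ⟨unitaryTwist (c : E →+* E) Φ γ, ?_⟩
  exact map_unitaryTwist (c : E →+* E) (conjAdele F E c) (algebraMap E (AdeleRing (𝓞 E) E)) (algebraMap_conj F E c) Φ γ

omit [NumberField F] in
/-- **`ε ∘ ε = id` ON `GL_n(𝔸_E)`** for `c² = 1` and `Φ` `c`-hermitian. [cite: Rogawski1990, §3.10 p. 33; §4.7 p. 47] -/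
theorem twistAdelic_twistAdelic (hc : c * c = 1) (hΦ : ((Φ : GL (Fin n) E) : Matrix (Fin n) (Fin n) E)ᵀ.map c = (Φ : Matrix (Fin n) (Fin n) E))
    (g : GL (Fin n) (AdeleRing (𝓞 E) E)) : twistAdelic F E n Φ c (twistAdelic F E n Φ c g) = g :=
  unitaryTwist_unitaryTwist (conjAdele F E c) (conjAdele_conjAdele (F := F) (E := E) (c := c) hc) (map_formAdelic_conjAdele_transpose F E n Φ c hΦ) g

variable {F}

/-- **A `c`-hermitian `Φ` stays hermitian over `E_v = E ⊗_F F_v`**: `((Φ ⊗ 1)ᵀ).map (c ⊗ 1) = Φ ⊗ 1` (★ `adeleToLocal_conj` ∘ ★ `algebraMap_conj`, through `𝔸_E → E_v`).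
[cite: Rogawski1990, §1.9 p. 8; §4.10 p. 57] -/
theorem map_formLocal_conjLocal_transpose (hΦ : ((Φ : GL (Fin n) E) : Matrix (Fin n) (Fin n) E)ᵀ.map c = (Φ : Matrix (Fin n) (Fin n) E))
    (v : HeightOneSpectrum (𝓞 F)) :
    ((formLocal E n Φ v).valᵀ).map (conjLocal E c v) =
      (formLocal E n Φ v).val := by
  -- push the adelic statement through `locCompGt v` (`Φ ⊗ 1 ↦ Φ ⊗ 1`, ★ `locCompGt_formAdelic`; `(c ⊗ 1) ↦ (c ⊗ 1)_v`, ★ `adeleToLocal_conj`)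
  have h := map_formAdelic_conjAdele_transpose F E n Φ c hΦ
  have e : (formLocal E n Φ v).val =
      ((formAdelic E n Φ : GL (Fin n) (AdeleRing (𝓞 E) E)) : Matrix (Fin n) (Fin n) (AdeleRing (𝓞 E) E)).map (adeleToLocal E v) := by
    rw [← locCompGt_formAdelic E n Φ v]
    rfl
  have hqp : (conjLocal E c v : LocalRing E v → LocalRing E v) ∘ (adeleToLocal E v) = (adeleToLocal E v) ∘ (conjAdele F E c) :=
    funext fun x => (adeleToLocal_conj E c v x).symm
  rw [e, ← Matrix.transpose_map, Matrix.map_map, hqp, ← Matrix.map_map, h]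

/-- **`ε_v ∘ ε_v = id` ON `GL_n(E_v)`** for a quadratic `E ∕ F` with `c δ = −δ`, `δ ≠ 0` (★ `conjLocal_conjLocal_apply`: `(c ⊗ 1)² = 1` on `E_v`) and `Φ` `c`-hermitian.
[cite: Rogawski1990, §3.11 p. 35; §4.10 p. 57] -/
theorem twistLocal_twistLocal [Algebra.IsQuadraticExtension F E] {δ : E} (hcδ : c δ = -δ) (hδ : δ ≠ 0)
    (hΦ : ((Φ : GL (Fin n) E) : Matrix (Fin n) (Fin n) E)ᵀ.map c = (Φ : Matrix (Fin n) (Fin n) E)) (v : HeightOneSpectrum (𝓞 F))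
    (g : GL (Fin n) (LocalRing E v)) : twistLocal E n Φ c v (twistLocal E n Φ c v g) = g :=
  unitaryTwist_unitaryTwist (conjLocal E c v) (Liu2021.LemD1OfPlace.conjLocal_conjLocal_apply E v c hcδ hδ) (map_formLocal_conjLocal_transpose E n Φ c hΦ v) g

/-- **The local twist preserves the rational points**: `ε_v(γ ⊗ 1) = γ′ ⊗ 1` for `γ ∈ GL_n(E)` (§1 functoriality at `E ↪ E_v`; the conjugations are intertwined because both legs
of `E ↪ 𝔸_E → E_v` are, ★ `algebraMap_conj` + ★ `adeleToLocal_conj`). [cite: Rogawski1990, §4.10 p. 57] -/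
theorem twistLocal_map_algebraMap_mem_range (v : HeightOneSpectrum (𝓞 F)) (γ : GL (Fin n) E) :
    twistLocal E n Φ c v (Matrix.GeneralLinearGroup.map (algebraMap E (LocalRing E v)) γ) ∈
      (Matrix.GeneralLinearGroup.map (n := Fin n) (algebraMap E (LocalRing E v))).range := by
  letI : TopologicalSpace E := ⊥
  have hconj : ∀ x : E, algebraMap E (LocalRing E v) ((c : E →+* E) x) = conjLocal E c v (algebraMap E (LocalRing E v) x) := fun x => by
    have h1 : algebraMap E (LocalRing E v) x = adeleToLocal E v (algebraMap E (AdeleRing (𝓞 E) E) x) := rfl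
    have h2 : algebraMap E (LocalRing E v) ((c : E →+* E) x) = adeleToLocal E v (algebraMap E (AdeleRing (𝓞 E) E) ((c : E →+* E) x)) := rfl
    rw [h1, h2, algebraMap_conj F E c, adeleToLocal_conj]
  refine ⟨unitaryTwist (c : E →+* E) Φ γ, ?_⟩
  exact map_unitaryTwist (c : E →+* E) (conjLocal E c v) (algebraMap E (LocalRing E v)) hconj Φ γ

end Global

end Summit.HodgeConjecture.HodgeConjecture.Cruxes.H413.K2E1TwistEpsilonInvolution

end
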